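import Literature.Algebra.Homology.DiscreteRepExtInternalHomTorsion
import Literature.NumberTheory.GaloisRepresentations.IdeleClassBarLatticeVanishing
import Literature.NumberTheory.GaloisRepresentations.SUnitsRestrictedKummer
import Literature.NumberTheory.GaloisCohomology.PoitouTateRestrictedRamification
import HarnessLib

/-!
# The comparison `Extⁿ_{C_{G_S}}(A, Ē_S) ≃+ Hⁿ(G_S, M^{N_S})` for a finite `G_S`-module `A` whose exponent is
# invertible in `𝒪_{K,S}` (Harari Lemma 17.21 (a) `Extʳ_{G_S}(M, E_S) = Hʳ(G_S, M′)`; Milne ADT I Lemma 4.12)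
# — the map `cmp` of the `S`-restricted `Ш`-pairing on Milne's `Ext` road

Topic `NumberTheory/GaloisCohomology`; namespace `Literature.NumberTheory.GaloisCohomology.RestrictedExt`.
Definitions WITH BODIES (two specialisations of door-c4's comparison `DiscreteRep.extIhomAddEquivContinuousCohomology`,
no new map) and theorems; no named fact, no instance, no notation, no `sorry`.  Sequel of
`Literature.Algebra.Homology.DiscreteRepExtInternalHomTorsion` (bsd-eis -w7 g12: door-c4's acyclicity hypothesis `hN`
discharged for `N` finitely generated killed by `m` and coefficients on which `m •` is onto) and of -w5's
`IdeleClassBarLatticeVanishing` §1 (`discTopRep X`, `stdBase_discTopRep : stdBase (discTopRep X) = X` — every object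
of `C_Γ` is the base of a standard complex).

THE STATEMENT IN PRINT.  Harari, *Galois Cohomology and Class Field Theory*, Lemma 17.21 (a) (p. 297): "Let `M` be
a finite `G_S`-module such that `#M ∈ 𝒪_{k,S}ˣ` … (a) We have `Extʳ_{G_S}(M, E_S) = Hʳ(G_S, M′)` for any `r ≥ 0`",
with `M′ = Hom(M, E_S)`; Milne, ADT I, Lemma 4.12 and §0 Example 0.8.  In the `S`-restricted `Ш`-pairing on the
`Ext` road (-w2 g11's `PoitouTateRestrictedShaExtRoad`, Milne I Thm. 4.10 (a) proof p. 58) this is the comparison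
`cmp : Ext²(A, Ē_S) → H²(G_S, M^{N_S})` (there `A` "is" `M^D`, and `Hom(M^D, Ē_S) = M`), required INJECTIVE
(`hcmp`) — here it is an additive EQUIVALENCE.

WHAT IS HERE.
* §1 (any compact `Γ`) **`extAddEquivContinuousCohomologyOfTorsion N X hN hXm Y hY e n : Ext N X n ≃+ Hⁿ_cont(Γ, Y)`**
  for OBJECTS `N X : C_Γ = DiscreteRepCat ℤ Γ` (`N` finitely generated over `ℤ` with `m • N = 0`, `m •` onto the
  carrier of `X`) and any discrete topological representation `Y` with open stabilisers identified with `Hom(N, X)`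
  in `C_Γ` (`e : stdBase Y hY ≅ ihomObj N X`): the object-level form of
  `DiscreteRep.extIhomAddEquivContinuousCohomologyOfTorsion` through `discTopRep`.
* §2 (`Γ := G_S = GaloisGroupUnramifiedOutside K S`) **`extAddEquivRestrictedCohomology ρ S A ES hA hES e n :
  Ext A ES n ≃+ restrictedCohomology ρ S n`** for a discrete `Γ_K`-module `ρ` on `M` (so that
  `restrictedCohomology ρ S n = Hⁿ(G_S, M^{N_S})`), objects `A ES : C_{G_S}` with `A` finitely generated killed by
  `m`, `m •` onto `ES`, and an identification `e : M^{N_S} ≅ Hom(A, ES)` in `C_{G_S}` (the PARAMETER through which the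
  instantiator feeds `Hom(M^D, Ē_S) = M` / the `e_S` of `SUnitsRestrictedTateDual`); `_injective`, `_bijective`.
* §3 the coefficient hypothesis for the `S`-units: **`exists_eq_nsmul_sUnitsRestricted`** — multiplication by `m` is
  onto `Ē_S = 𝒪_{K_S,S}ˣ` (the carrier of `sUnitsRestricted K S`) as soon as every prime factor `p` of `m ≠ 0` has all
  places above it in `S` (iterate `SUnits.zsmul_surjective_sUnitsRestricted` over the factorisation of `m`).

Written for the background lane «PT-Ш-S-TC» of crux `stmt-BirchSwinnertonDyer-19032` (cell bsd-eis, seat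
bsd-line-x1-p1-w7 gen 12), brick D4a on the `Ext` road.  Not here: the naturality of the comparison in `A`
(`hcmpG` of `ShaExtRoad.pairing_natural`) — sequel file.  HONEST FRAMING: a comparison isomorphism of homological
algebra plus one divisibility statement; no duality theorem and no case of BSD is proved here.  AI formalisation,
established only by the kernel check.

## References
* D. Harari, *Galois Cohomology and Class Field Theory*, Universitext (2020), Lemma 17.21 (a) and its proof (p. 297),
  §16.2 Prop. 16.16. [Harari2020]
* J. S. Milne, *Arithmetic Duality Theorems*, 2nd ed. (2006), I §0 Example 0.8, I Lemma 4.12, I Thm. 4.10 (a) (proof,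
  p. 58). [MilneADT2006]
* J. Neukirch, A. Schmidt, K. Wingberg, *Cohomology of Number Fields*, 2nd ed. (2008), VIII §3, (8.3.18)
  (the Kummer sequence for `E_S`). [NeukirchSchmidtWingberg2008]
-/

noncomputable section

open CategoryTheory CategoryTheory.Abelian NumberField IsDedekindDomain
open Literature.Algebra.Homology Literature.Algebra.Homology.DiscreteRep
open Literature.NumberTheory.GaloisRepresentations
open scoped NumberField

namespace Literature.NumberTheory.GaloisCohomology

namespace RestrictedExt

/-! ## §1 Object-level comparison in `C_Γ` -/

section ObjectLevel

variable {Γ : Type} [Group Γ] [TopologicalSpace Γ] [IsTopologicalGroup Γ] [CompactSpace Γ]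
  (N X : DiscreteRepCat ℤ Γ) [hNfin : @Module.Finite ℤ N.obj.V _ _ N.obj.hV2]

/-- **`Extⁿ_{C_Γ}(N, X) ≃+ Hⁿ_cont(Γ, Y)` for objects `N X ∈ C_Γ`**, `N` finitely generated over `ℤ` with `m • N = 0`,
`m •` onto the carrier of `X`, and `Y` any discrete topological representation with open stabilisers identified with
`Hom(N, X)` in `C_Γ` — door-c4's comparison on the standard complex of `discTopRep X` (whose base IS `X`), with its
acyclicity hypothesis discharged by `ext_stdComplex_X_eq_zero_of_torsion`.
[cite: Harari2020, Lemma 17.21 (a)][cite: MilneADT2006, I §0 Example 0.8] -/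
def extAddEquivContinuousCohomologyOfTorsion {m : ℕ} (hN : ∀ a : N.obj.V, m • a = 0)
    (hXm : ∀ x : X.obj.V, ∃ y, x = m • y) (Y : TopRep.{0} ℤ Γ) [DiscreteTopology Y.V]
    (hY : IsDiscrete ((forgetTop ℤ Γ).obj Y)) (e : stdBase Y hY ≅ ihomObj N X) (n : ℕ) :
    Ext N X n ≃+ (continuousCohomology n Y : TopModuleCat.{0} ℤ) :=
  haveI := discreteTopology_discTopRep X
  extIhomAddEquivContinuousCohomologyOfTorsion N (discTopRep X) (isDiscrete_discTopRep X) hN hXm Y hY e n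

/-- It is door-c4's `extIhomAddEquivContinuousCohomology` on `discTopRep X` (no new map).
[cite: Harari2020, Lemma 17.21 (a)] -/
theorem extAddEquivContinuousCohomologyOfTorsion_eq {m : ℕ} (hN : ∀ a : N.obj.V, m • a = 0)
    (hXm : ∀ x : X.obj.V, ∃ y, x = m • y) (Y : TopRep.{0} ℤ Γ) [DiscreteTopology Y.V]
    (hY : IsDiscrete ((forgetTop ℤ Γ).obj Y)) (e : stdBase Y hY ≅ ihomObj N X) (n : ℕ) :
    extAddEquivContinuousCohomologyOfTorsion N X hN hXm Y hY e n =
      @extIhomAddEquivContinuousCohomology ℤ Γ _ _ _ _ _ _ N hNfin (discTopRep X)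
        (discreteTopology_discTopRep X) (isDiscrete_discTopRep X)
        (@ext_stdComplex_X_eq_zero_of_torsion Γ _ _ _ _ N hNfin (discTopRep X) (discreteTopology_discTopRep X)
          (isDiscrete_discTopRep X) m hN hXm) Y _ hY e n :=
  rfl

/-- The object-level comparison is bijective. [cite: Harari2020, Lemma 17.21 (a)] -/
theorem extAddEquivContinuousCohomologyOfTorsion_bijective {m : ℕ} (hN : ∀ a : N.obj.V, m • a = 0)
    (hXm : ∀ x : X.obj.V, ∃ y, x = m • y) (Y : TopRep.{0} ℤ Γ) [DiscreteTopology Y.V]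
    (hY : IsDiscrete ((forgetTop ℤ Γ).obj Y)) (e : stdBase Y hY ≅ ihomObj N X) (n : ℕ) :
    Function.Bijective (extAddEquivContinuousCohomologyOfTorsion N X hN hXm Y hY e n).toAddMonoidHom :=
  (extAddEquivContinuousCohomologyOfTorsion N X hN hXm Y hY e n).bijective

end ObjectLevel

/-! ## §2 `Γ := G_S`: values in `restrictedCohomology ρ S n = Hⁿ(G_S, M^{N_S})` -/

section Restricted

variable {K : Type} [Field K] [NumberField K] {M : Type} [AddCommGroup M] [TopologicalSpace M]
  [DiscreteTopology M] (ρ : DiscreteGaloisModule K M) (S : Set (HeightOneSpectrum (𝓞 K)))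
  (A ES : DiscreteRepCat ℤ (GaloisGroupUnramifiedOutside K S)) [hAfin : @Module.Finite ℤ A.obj.V _ _ A.obj.hV2]

omit [NumberField K] in
/-- The `G_S`-module `M^{N_S}` (the coefficients of `restrictedCohomology ρ S`) has open stabilisers.
[cite: Harari2020, §17.2 (p. 290)] -/
theorem isDiscrete_quotientInvariants :
    IsDiscrete ((forgetTop ℤ (GaloisGroupUnramifiedOutside K S)).obj
      (ρ.quotientInvariants (ramificationSubgroup K S)).toTopRep) :=
  isDiscrete_of_continuousRep (ρ.quotientInvariants (ramificationSubgroup K S))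

/-- **`Extⁿ_{C_{G_S}}(A, ES) ≃+ Hⁿ(G_S, M^{N_S})`** (`restrictedCohomology ρ S n`) for `A` finitely generated over `ℤ`
killed by `m`, `m •` onto the carrier of `ES`, given an identification `e : M^{N_S} ≅ Hom(A, ES)` in `C_{G_S}` —
Harari Lemma 17.21 (a) `Extʳ_{G_S}(M^D, E_S) = Hʳ(G_S, Hom(M^D, E_S)) = Hʳ(G_S, M)` with the identification left to the
instantiator (`Hom(M^D, Ē_S) = M`, the `e_S` of `SUnitsRestrictedTateDual`); the `cmp` of
`ShaExtRoad.pairing_perfect` as an additive EQUIVALENCE.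
[cite: Harari2020, Lemma 17.21 (a)][cite: MilneADT2006, I Lemma 4.12, I Thm. 4.10 (a) (proof, p. 58)] -/
def extAddEquivRestrictedCohomology {m : ℕ} (hA : ∀ a : A.obj.V, m • a = 0)
    (hES : ∀ x : ES.obj.V, ∃ y, x = m • y)
    (e : stdBase (ρ.quotientInvariants (ramificationSubgroup K S)).toTopRep (isDiscrete_quotientInvariants ρ S) ≅
      ihomObj A ES) (n : ℕ) :
    Ext A ES n ≃+ DiscreteGaloisModule.restrictedCohomology ρ S n :=
  extAddEquivContinuousCohomologyOfTorsion A ES hA hES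
    (ρ.quotientInvariants (ramificationSubgroup K S)).toTopRep (isDiscrete_quotientInvariants ρ S) e n

/-- **`cmp` is injective** (the hypothesis `hcmp` of `ShaExtRoad.pairing_perfect` / `exists_idelePart_of_obstruction_eq_zero`).
[cite: MilneADT2006, I Thm. 4.10 (a) (proof, p. 58)] -/
theorem extAddEquivRestrictedCohomology_injective {m : ℕ} (hA : ∀ a : A.obj.V, m • a = 0)
    (hES : ∀ x : ES.obj.V, ∃ y, x = m • y)
    (e : stdBase (ρ.quotientInvariants (ramificationSubgroup K S)).toTopRep (isDiscrete_quotientInvariants ρ S) ≅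
      ihomObj A ES) (n : ℕ) :
    Function.Injective (extAddEquivRestrictedCohomology ρ S A ES hA hES e n).toAddMonoidHom :=
  (extAddEquivRestrictedCohomology ρ S A ES hA hES e n).injective

/-- **`cmp` is bijective** (`Extʳ_{G_S}(M^D, E_S) = Hʳ(G_S, M)` is an isomorphism).
[cite: Harari2020, Lemma 17.21 (a)] -/
theorem extAddEquivRestrictedCohomology_bijective {m : ℕ} (hA : ∀ a : A.obj.V, m • a = 0)
    (hES : ∀ x : ES.obj.V, ∃ y, x = m • y)
    (e : stdBase (ρ.quotientInvariants (ramificationSubgroup K S)).toTopRep (isDiscrete_quotientInvariants ρ S) ≅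
      ihomObj A ES) (n : ℕ) :
    Function.Bijective (extAddEquivRestrictedCohomology ρ S A ES hA hES e n).toAddMonoidHom :=
  (extAddEquivRestrictedCohomology ρ S A ES hA hES e n).bijective

end Restricted

/-! ## §3 The coefficient hypothesis for `Ē_S = 𝒪_{K_S,S}ˣ` -/

section SUnits

variable (K : Type) [Field K] [NumberField K] (S : Set (HeightOneSpectrum (𝓞 K)))

/-- **Multiplication by `m` is onto `Ē_S = 𝒪_{K_S,S}ˣ`** (the carrier of `sUnitsRestricted K S`) when `m ≠ 0` and every
prime factor `p` of `m` has all places above `p` in `S` — i.e. `m ∈ 𝒪_{K,S}ˣ`; iterate the `p`-divisibility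
`SUnits.zsmul_surjective_sUnitsRestricted` (Kummer theory unramified outside `S ⊇ S_p`) over the prime factorisation.
[cite: Harari2020, Lemma 17.21 (a) (proof: "`E_S` is `ℓ`-divisible for any prime number `ℓ` invertible in `𝒪_{k,S}`")]
[cite: NeukirchSchmidtWingberg2008, VIII §3 (8.3.18)] -/
theorem exists_eq_nsmul_sUnitsRestricted {m : ℕ} (hm : m ≠ 0)
    (hS : ∀ p : ℕ, p.Prime → p ∣ m → ∀ v : HeightOneSpectrum (𝓞 K), ((p : ℕ) : 𝓞 K) ∈ v.asIdeal → v ∈ S) :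
    ∀ w : Representation.invariants
      ((SUnits.sUnitsModule K S).toRepresentation.comp (ramificationSubgroup K S).subtype),
    ∃ w', w = m • w' := by
  induction m using UniqueFactorizationMonoid.induction_on_prime with
  | h₁ => exact absurd rfl hm
  | h₂ x hx =>
    obtain rfl := Nat.isUnit_iff.1 hx
    exact fun w => ⟨w, by rw [one_smul]⟩
  | h₃ a p ha hp ih =>
    intro w
    have hpp : p.Prime := Nat.prime_iff.2 hp
    haveI : Fact p.Prime := ⟨hpp⟩
    -- divide by `p` (Kummer, `S ⊇ S_p`), then by `a` (induction)
    obtain ⟨w₁, hw₁⟩ := SUnits.zsmul_surjective_sUnitsRestricted K S (p := p)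
      (hS p hpp (Dvd.intro a rfl)) w
    obtain ⟨w₂, hw₂⟩ := ih ha (fun q hq hqa => hS q hq (Dvd.dvd.mul_left hqa p)) w₁
    refine ⟨w₂, ?_⟩
    have hw₁' : w = p • w₁ := by
      rw [← hw₁]
      change (p : ℤ) • w₁ = p • w₁
      rw [natCast_zsmul]
    rw [hw₁', hw₂, smul_smul]

end SUnits

end RestrictedExt

end Literature.NumberTheory.GaloisCohomology

end
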